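import Mathlib
import Literature.NumberTheory.Automorphic.StrongArtinGL2GlobalQuotientMeromorphicProofs
import Summits.Langlands.Langlands.Theorems.SkinnerWilesDefectOneStrongLiftingAllFiniteEulerZeros

/-!
# The ramified clause of `StrongLiftingAllFinite` from the quotient of the two functional
# equations (Jacquet–Langlands' global half for `GL_n`; item stmt-Langlands-15194)

Sibling of `…EulerZeros` (the local half).  The tree proves, for Gelbart's Prop. 4.1 (`GL₂`, Artin
against cuspidal), the step "taking the quotient of the two functional equations"
(`quotient_of_functional_equations`, `StrongArtinGL2GlobalQuotientProofs`) and its meromorphic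
packaging (`StrongArtinGL2GlobalQuotientMeromorphicProofs`).  THIS FILE transposes them to the
RAMIFIED CLAUSE (R): `π` cuspidal on `GL_n(𝔸_F)` unramified at the place `v₀` ramified in the
cyclic prime-degree `E/F` with Satake parameter `α`, `P` a cuspidal weak lift, `w₀` the place of `E`
above `v₀` (`q_{w₀} = q_{v₀} = q`), `(u_i, m_i)` the Euler data of the lift at `w₀`:

* `ramifiedClause_of_global_functional_equations` — from four functions `Λ_π, Λ_P, Λ_π', Λ_P'`
  holomorphic off a closed countable `P ⊆ ℂ` stable under `s ↦ 1 - s` (the completed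
  `∏_i Λ(s, ω ⊗ π ⊗ ηⁱ)`, `Λ(s, (ω ∘ N) ⊗ P)` and their contragredient partners, `ω` an idèle class
  character trivial at `v₀` and highly ramified at the other exceptional places), entire reciprocal
  archimedean factors `Γ_•` vanishing on finitely many horizontal lines, continuous `ε_π, ε_P`
  (`ε_P` nowhere zero), the Euler-factor agreements off `v₀, ∞` in cross-multiplied form —
  `Λ_π ∏_{a ∈ α}(1 - a q^{-s}) Γ_π = Λ_P ∏_i (1 - u_i q^{-s}) Γ_P` and
  `Λ_π' ∏_{a ∈ α}(1 - a⁻¹ q^{-s}) Γ_π' = Λ_P' ∏_i (1 - u_i⁻¹ q^{-(m_i-1)} q^{-s}) Γ_P'` for `re s > c` —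
  the two functional equations off `P` and `Λ_π' ≢ 0`: every `m_i = 1` and `α = {u_i}`.
* `ramifiedClause_of_meromorphic_functional_equations` — the same from Mathlib-`Meromorphic`
  `Λ_•` with pointwise functional equations and archimedean factors `∏_{m ∈ μ} Γ_ℝ(s + m)`.

Pure packaging (no automorphic input): `quotient_of_functional_equations` +
`ramifiedClause_of_local_identity`.  Helper for the item (does not close it).

## References

* H. Jacquet, R. P. Langlands, *Automorphic Forms on GL(2)*, LNM 114 (1970), proof of Thm. 12.2,
  pp. 209–211. [JacquetLanglands1970]
* J. Arthur, L. Clozel, Ann. of Math. Stud. 120 (1989), Ch. 3, Thm. 5.1. [ArthurClozelAMS120]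
-/

set_option linter.dupNamespace false -- project-wide option (lakefile weak.linter.dupNamespace); `Summit.Langlands.Langlands` is the mandated namespace

noncomputable section

open Polynomial Finset Complex Filter Topology Set
open Literature.NumberTheory.LFunctions Literature.NumberTheory.Automorphic

namespace Summit.Langlands.Langlands.Theorems.SkinnerWilesDefectOne.StrongLiftingAllFinite

section Global

variable {q : ℕ} {ι : Type*} [Fintype ι]

/-- Differentiability of `s ↦ ∏_i (1 - g_i q^{-s})` (`q ≠ 0`). [folklore] -/
theorem differentiable_finprod_eulerTerm (hq : q ≠ 0) (g : ι → ℂ) :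
    Differentiable ℂ fun s : ℂ => ∏ i, eulerTerm q (g i) s := by
  have h : Differentiable ℂ (∏ i ∈ (Finset.univ : Finset ι), eulerTerm q (g i)) :=
    Differentiable.finsetProd fun i _ => differentiable_eulerTerm hq (g i)
  convert h using 1
  funext s
  exact (Finset.prod_apply s Finset.univ (fun i => eulerTerm q (g i))).symm

/-- **The ramified clause from the quotient of the two functional equations** (the `GL_n`
analogue of `frobSatake_of_global_functional_equations`; see the module docstring for the
dictionary).  `q > 1`; `α` non-zero and generic (`b ≠ q a`); blocks `(u_i, m_i)`, `u_i ≠ 0`,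
`m_i ≥ 1`; `P ⊆ ℂ` closed countable and stable under `s ↦ 1 - s`; `Λ_π, Λ_P, Λ_π', Λ_P'`
holomorphic off `P`; `Γ_π, Γ_P, Γ_π', Γ_P'` entire, `Γ_P` and `Γ_π'` vanishing only on finitely
many horizontal lines; `ε_π, ε_P` continuous, `ε_P` nowhere zero; the agreements
`Λ_π ∏_{a ∈ α}(1 - a q^{-s}) Γ_π = Λ_P (∏_i (1 - u_i q^{-s})) Γ_P`,
`Λ_π' ∏_{a ∈ α}(1 - a⁻¹ q^{-s}) Γ_π' = Λ_P' (∏_i (1 - u_i⁻¹ q^{-(m_i-1)} q^{-s})) Γ_P'` for `re s > c`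
off `P`; `Λ_π(s) = ε_π(s) Λ_π'(1 - s)` and `Λ_P(s) = ε_P(s) Λ_P'(1 - s)` off `P`; `Λ_π' ≢ 0` off
`P`.  Then every `m_i = 1` and `α = {u_i}_i`.
[cite: JacquetLanglands1970, proof of Thm. 12.2, pp. 209–211] -/
theorem ramifiedClause_of_global_functional_equations (hq : 1 < q) {α : Multiset ℂ}
    (h0 : (0 : ℂ) ∉ α) (hgen : ∀ a ∈ α, ∀ b ∈ α, b ≠ (q : ℂ) * a)
    (u : ι → ℂ) (m : ι → ℕ) (hu : ∀ i, u i ≠ 0) (hm : ∀ i, 1 ≤ m i)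
    {P : Set ℂ} (hPc : IsClosed P) (hP : P.Countable) (hPs : ∀ s ∈ P, 1 - s ∈ P)
    {Λπ ΛP Λπ' ΛP' : ℂ → ℂ} (hΛπ : DifferentiableOn ℂ Λπ Pᶜ) (hΛP : DifferentiableOn ℂ ΛP Pᶜ)
    (hΛπ' : DifferentiableOn ℂ Λπ' Pᶜ) (hΛP' : DifferentiableOn ℂ ΛP' Pᶜ)
    {Γπ ΓP Γπ' ΓP' επ εP : ℂ → ℂ} (hΓπ : Differentiable ℂ Γπ) (hΓP : Differentiable ℂ ΓP)
    (hΓπ' : Differentiable ℂ Γπ') (hΓP' : Differentiable ℂ ΓP') (hεπ : Continuous επ)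
    (hεP : Continuous εP) (hεP0 : ∀ s, εP s ≠ 0)
    (hYP : ∃ Y : Set ℝ, Y.Finite ∧ ∀ s, ΓP s = 0 → s.im ∈ Y)
    (hYπ' : ∃ Y : Set ℝ, Y.Finite ∧ ∀ s, Γπ' s = 0 → s.im ∈ Y)
    {c : ℝ}
    (hE : ∀ s, c < s.re → s ∉ P →
      Λπ s * ((α.map fun a => eulerTerm q a s).prod * Γπ s) =
        ΛP s * ((∏ i, eulerTerm q (u i) s) * ΓP s))
    (hE' : ∀ s, c < s.re → s ∉ P →
      Λπ' s * ((α.map fun a => eulerTerm q a⁻¹ s).prod * Γπ' s) =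
        ΛP' s * ((∏ i, eulerTerm q ((u i)⁻¹ * ((q : ℂ)⁻¹) ^ (m i - 1)) s) * ΓP' s))
    (hFπ : ∀ s, s ∉ P → Λπ s = επ s * Λπ' (1 - s))
    (hFP : ∀ s, s ∉ P → ΛP s = εP s * ΛP' (1 - s))
    (hNV : ∃ s, s ∉ P ∧ Λπ' s ≠ 0) :
    (∀ i, m i = 1) ∧ α = ∑ i, ({u i} : Multiset ℂ) := by
  have hq0 : q ≠ 0 := by omega
  -- the local factors at `v₀` are entire
  have hAπ : Differentiable ℂ fun s : ℂ => (α.map fun a => eulerTerm q a s).prod :=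
    differentiable_multiset_prod_eulerTerm hq0 α
  have hAπ' : Differentiable ℂ fun s : ℂ => (α.map fun a => eulerTerm q a⁻¹ s).prod := by
    have h := differentiable_multiset_prod_eulerTerm hq0 (α.map fun a => a⁻¹)
    simp only [Multiset.map_map, Function.comp_def] at h
    exact h
  have hAP : Differentiable ℂ fun s : ℂ => ∏ i, eulerTerm q (u i) s :=
    differentiable_finprod_eulerTerm hq0 u
  have hAP' : Differentiable ℂ fun s : ℂ =>
      ∏ i, eulerTerm q ((u i)⁻¹ * ((q : ℂ)⁻¹) ^ (m i - 1)) s :=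
    differentiable_finprod_eulerTerm hq0 _
  -- the quotient of the functional equations (Jacquet–Langlands p. 209)
  have hid := quotient_of_functional_equations hPc hP hPs hΛπ hΛP hΛπ' hΛP' (hAπ.fun_mul hΓπ)
    (hAP.fun_mul hΓP) (hAπ'.fun_mul hΓπ') (hAP'.fun_mul hΓP') hεπ hεP hE hE' hFπ hFP hNV
  -- in the form of the local half
  have hid' : ∀ s : ℂ,
      (επ s * Γπ s * ΓP' (1 - s)) * (α.map fun a => eulerTerm q a s).prod *
          ∏ i, (1 - (u i)⁻¹ * ((q : ℂ)⁻¹) ^ (m i - 1) * (q : ℂ) ^ (-(1 - s))) =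
        (εP s * ΓP s * Γπ' (1 - s)) * (∏ i, eulerTerm q (u i) s) *
          (α.map fun a => 1 - a⁻¹ * (q : ℂ) ^ (-(1 - s))).prod := fun s => by
    have h := hid s
    beta_reduce at h
    have e1 : ∏ i, (1 - (u i)⁻¹ * ((q : ℂ)⁻¹) ^ (m i - 1) * (q : ℂ) ^ (-(1 - s))) =
        ∏ i, eulerTerm q ((u i)⁻¹ * ((q : ℂ)⁻¹) ^ (m i - 1)) (1 - s) :=
      Finset.prod_congr rfl fun i _ => by rw [eulerTerm_def]
    have e2 : (α.map fun a => 1 - a⁻¹ * (q : ℂ) ^ (-(1 - s))).prod =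
        (α.map fun a => eulerTerm q a⁻¹ (1 - s)).prod :=
      congrArg Multiset.prod (Multiset.map_congr rfl fun a _ => by rw [eulerTerm_def])
    rw [e1, e2]
    linear_combination h
  -- the exceptional set: zeros of `Φ = ε_P Γ_P Γ_π'(1 - ·)`, on finitely many horizontal lines
  obtain ⟨YP, hYPf, hYP⟩ := hYP
  obtain ⟨Yπ, hYπf, hYπ⟩ := hYπ'
  have h1s : Continuous fun s : ℂ => 1 - s := continuous_const.sub continuous_id
  have hΦc : Continuous fun s => εP s * ΓP s * Γπ' (1 - s) :=
    (hεP.mul hΓP.continuous).mul (hΓπ'.continuous.comp h1s)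
  have hΨc : Continuous fun s => επ s * Γπ s * ΓP' (1 - s) :=
    (hεπ.mul hΓπ.continuous).mul (hΓP'.continuous.comp h1s)
  have hEim : ∀ s : ℂ, εP s * ΓP s * Γπ' (1 - s) = 0 → s.im ∈ YP ∪ (fun y => -y) '' Yπ := by
    intro s hs
    rcases mul_eq_zero.mp hs with h | h
    · rcases mul_eq_zero.mp h with h | h
      · exact absurd h (hεP0 s)
      · exact Or.inl (hYP s h)
    · exact Or.inr ⟨(1 - s).im, hYπ _ h, by simp⟩
  have hEfin : ∀ z : ℂ, z ≠ 0 →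
      {s | s ∈ {s : ℂ | εP s * ΓP s * Γπ' (1 - s) = 0} ∧ eulerTerm q z s = 0}.Finite :=
    fun z _ => (finite_setOf_eulerTerm_eq_zero_and_im_mem hq z (hYPf.union (hYπf.image _))).subset
      fun s ⟨hsE, hs0⟩ => ⟨hs0, hEim s hsE⟩
  exact ramifiedClause_of_local_identity hq h0 hgen u m hu hm (isClosed_eq hΦc continuous_const)
    hEfin hΦc.continuousOn hΨc.continuousOn (fun s hs => hs) fun s _ => hid' s

/-- **The ramified clause from meromorphic functional equations** (the `GL_n` analogue of
`frobSatake_of_meromorphic_functional_equations`, the form delivered by the tree's `L`-function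
predicates): `Λ_π, Λ_P, Λ_π', Λ_P'` Mathlib-`Meromorphic` on `ℂ`, archimedean data
`μ_π, μ_P, μ_π', μ_P'` (`L_∞ = ∏_{m ∈ μ} Γ_ℝ(s + m)`), continuous `ε_π, ε_P` (`ε_P` nowhere zero), the
two cross-multiplied Euler-factor agreements for `re s > c`, the two functional equations for all
`s`, and `Λ_π'` non-zero at some point of analyticity.  Then every `m_i = 1` and `α = {u_i}_i`.
[cite: JacquetLanglands1970, proof of Thm. 12.2, pp. 209–211] -/
theorem ramifiedClause_of_meromorphic_functional_equations (hq : 1 < q) {α : Multiset ℂ}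
    (h0 : (0 : ℂ) ∉ α) (hgen : ∀ a ∈ α, ∀ b ∈ α, b ≠ (q : ℂ) * a)
    (u : ι → ℂ) (m : ι → ℕ) (hu : ∀ i, u i ≠ 0) (hm : ∀ i, 1 ≤ m i)
    {Λπ ΛP Λπ' ΛP' : ℂ → ℂ} (hΛπ : Meromorphic Λπ) (hΛP : Meromorphic ΛP)
    (hΛπ' : Meromorphic Λπ') (hΛP' : Meromorphic ΛP') (μπ μP μπ' μP' : Multiset ℂ)
    {επ εP : ℂ → ℂ} (hεπ : Continuous επ) (hεP : Continuous εP) (hεP0 : ∀ s, εP s ≠ 0) {c : ℝ}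
    (hE : ∀ s : ℂ, c < s.re →
      Λπ s * ((α.map fun a => eulerTerm q a s).prod * (μπ.map fun m => (Gammaℝ (s + m))⁻¹).prod) =
        ΛP s * ((∏ i, eulerTerm q (u i) s) * (μP.map fun m => (Gammaℝ (s + m))⁻¹).prod))
    (hE' : ∀ s : ℂ, c < s.re →
      Λπ' s * ((α.map fun a => eulerTerm q a⁻¹ s).prod *
          (μπ'.map fun m => (Gammaℝ (s + m))⁻¹).prod) =
        ΛP' s * ((∏ i, eulerTerm q ((u i)⁻¹ * ((q : ℂ)⁻¹) ^ (m i - 1)) s) *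
          (μP'.map fun m => (Gammaℝ (s + m))⁻¹).prod))
    (hFπ : ∀ s, Λπ s = επ s * Λπ' (1 - s)) (hFP : ∀ s, ΛP s = εP s * ΛP' (1 - s))
    (hNV : ∃ s, AnalyticAt ℂ Λπ' s ∧ Λπ' s ≠ 0) :
    (∀ i, m i = 1) ∧ α = ∑ i, ({u i} : Multiset ℂ) := by
  obtain ⟨P, hPc, hP, hPs, hPa⟩ := exists_isClosed_countable_analyticAt hΛπ hΛP hΛπ' hΛP'
  -- `Λ_π' ≢ 0` off `P`: non-zero near `s₀`, and `ℂ ∖ P` is dense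
  have hNV' : ∃ s, s ∉ P ∧ Λπ' s ≠ 0 := by
    obtain ⟨s₀, hs₀a, hs₀⟩ := hNV
    obtain ⟨s, hsP, hs⟩ := (Set.Countable.dense_compl ℂ hP).inter_nhds_nonempty
      (hs₀a.continuousAt.preimage_mem_nhds (isOpen_ne.mem_nhds hs₀))
    exact ⟨s, hsP, hs⟩
  have hd : ∀ {Λ : ℂ → ℂ}, (∀ s, s ∉ P → AnalyticAt ℂ Λ s) → DifferentiableOn ℂ Λ Pᶜ :=
    fun h s hs => (h s hs).differentiableAt.differentiableWithinAt
  exact ramifiedClause_of_global_functional_equations hq h0 hgen u m hu hm hPc hP hPs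
    (hd fun s hs => (hPa s hs).1) (hd fun s hs => (hPa s hs).2.1)
    (hd fun s hs => (hPa s hs).2.2.1) (hd fun s hs => (hPa s hs).2.2.2)
    (Γπ := fun s => (μπ.map fun m => (Gammaℝ (s + m))⁻¹).prod)
    (ΓP := fun s => (μP.map fun m => (Gammaℝ (s + m))⁻¹).prod)
    (Γπ' := fun s => (μπ'.map fun m => (Gammaℝ (s + m))⁻¹).prod)
    (ΓP' := fun s => (μP'.map fun m => (Gammaℝ (s + m))⁻¹).prod)
    (differentiable_multiset_prod_Gammaℝ_inv μπ) (differentiable_multiset_prod_Gammaℝ_inv μP)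
    (differentiable_multiset_prod_Gammaℝ_inv μπ') (differentiable_multiset_prod_Gammaℝ_inv μP')
    hεπ hεP hεP0
    ⟨_, finite_image_neg_im μP, fun s hs => im_mem_of_multiset_prod_Gammaℝ_inv_eq_zero μP hs⟩
    ⟨_, finite_image_neg_im μπ', fun s hs => im_mem_of_multiset_prod_Gammaℝ_inv_eq_zero μπ' hs⟩
    (fun s hs _ => hE s hs) (fun s hs _ => hE' s hs) (fun s _ => hFπ s) (fun s _ => hFP s) hNV'

end Global

end Summit.Langlands.Langlands.Theorems.SkinnerWilesDefectOne.StrongLiftingAllFinite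

end
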